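import Literature.NumberTheory.Transcendental.NumCondFamily
import Literature.NumberTheory.Transcendental.TorsionEnvelopes
import Literature.NumberTheory.Transcendental.TorsionFamily
import Literature.NumberTheory.Transcendental.NewPointsTorsion
import HarnessLib

/-!
# The numerical condition of the torsion case along its family; `AdmissibleParams₃`

Topic: `Literature/NumberTheory/Transcendental`. Plan item W4 (closing, torsion case, part 5c)
of the unit `provefact-Literature.NumberTheory.Transcendental.H-b596640137`. Along the family
of `TorsionFamily.lean` every envelope of a factor of `NewPointsTorsion.NumCond₃`
(`TorsionEnvelopes.lean`, `NumCondEnvelopes.lean`) is dominated by the corresponding envelope of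
the comparison family `fam = ⟨a, b, ℓ + sp⟩` of `ParameterFamily.lean` (the cheap degree is
smaller, `n·D' ≤ fam.Dn` once `σ ≥ P₀`; the ranges `S, S₁, R` are smaller; the Siegel point range
`sp·S_rows + 1 ≤ σ^n = S₀ + 1` once `σ ≥ sp·P₀`), so the exponent inequality
`NumCondExponents.exponent_ineq` of `fam` yields `NumCond₃` (`BakerData.numCond₃_family`).
Together with the elementary clauses and the numerics of `TorsionFamily.lean` this discharges the
admissible-parameter hypothesis of the torsion-case closing: `AdmissibleParams₃` (definition) and
`BakerData.admissibleParams₃_of_lt` — for every Baker datum with `dd < n`, every `c > 0`, every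
number of rows `S_rows + 1` and every spacing `sp > c·κ₃^n·n!`.

## References

* A. Baker, G. Wüstholz, *Logarithmic Forms and Diophantine Geometry*, CUP 2007, §6.8 (pp. 117–119).
-/

noncomputable section

open Complex MvPolynomial Finset NumberField
open scoped PeriodPair

namespace Literature.NumberTheory.Transcendental

namespace GaGmE

namespace Std

namespace BakerData

variable {β γ δ : Type} [Fintype β] [Fintype γ] [Fintype δ] [DecidableEq γ]
variable [DecidableEq β] [DecidableEq δ] (B : BakerData β γ δ)

omit [DecidableEq β] [DecidableEq δ] in
/-- `expE` is monotone in `D`. [folklore] -/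
theorem expE_mono_left {D D₂ : ℕ} (h : D ≤ D₂) (k : ℕ) : B.expE D k ≤ B.expE D₂ k := by
  unfold expE
  have := Nat.mul_le_mul_right B.hdeg h
  omega

/-- **`NumCond₃` holds along the torsion family** (for `σ` beyond explicit thresholds), for every
coefficient vector within the Siegel house bound of the spaced system. Hypotheses: `n ≥ 1`,
`a·dd + 2b + 2n + 4 ≤ a·n`, `b ≥ b₀(fam)`, a natural `G' ≥ G` and `σ ≥ G'`, `σ ≥ sp·P₀`, and the
thresholds of `NumCondExponents.exponent_ineq` and `Family.sizes_le_W` for `fam`.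
[cite: BakerWustholz2007, §6.8 (p. 119)] -/
theorem numCond₃_family (F : TFamily) {n : ℕ} (hn' : Fintype.card (β ⊕ (γ ⊕ δ)) = n) (hn : 1 ≤ n)
    (ha : F.a * B.dd + 2 * F.b + 2 * n + 4 ≤ F.a * n)
    (hb : Family.b₀ F.fam n B.dd B.gens.h B.hdeg ≤ F.b)
    {G' : ℕ} (hG' : B.bigConst ≤ G') {σ : ℕ} (hσG : G' ≤ σ)
    (hσ1 : Family.κD n B.dd * (1 + (2 * (n * (F.ℓ + F.sp)) + 3) ^ 2 * G' ^ 2) ≤ σ)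
    (hσ2 : Family.κD n B.dd * (2 + (n * (F.ℓ + F.sp)) ^ 2) ≤ σ)
    (hσ3 : (F.a * n + 1) * (4 * n + 3 * n + B.gens.h * (4 * n + 3 * n + B.hdeg * Family.κD n B.dd + 4 * n) +
        B.gens.h * (4 * n + B.hdeg * Family.κD n B.dd + 8 * n)) ≤ σ)
    (hσW : B.hdeg * Family.κD n B.dd + 8 * n + n * (F.ℓ + F.sp) + Family.κD n B.dd + 3 ≤ σ)
    (hσP : F.sp * F.P₀ ≤ σ)
    {ξ : UIdx β γ δ (F.D' n B.dd σ) → 𝓞 B.K}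
    (hξ : ∀ u, house ((ξ u : 𝓞 B.K) : B.K) ≤ B.siegelHouseBound₃ F.sp (F.D' n B.dd σ) (F.T n σ) F.Srows) :
    B.NumCond₃ ξ F.sp (F.T n σ) (Family.S₀ n σ) (F.S₁ n σ) (F.T' n σ) (F.R n σ) := by
  -- the comparison family and its identifications
  set Fm : Family := F.fam with hFm
  have hFa : Fm.a = F.a := rfl
  have hFb : Fm.b = F.b := rfl
  have hFℓ : Fm.ℓ = F.ℓ + F.sp := rfl
  have hT : F.T n σ = Fm.T n σ := rfl
  have hT' : F.T' n σ = Fm.T' n σ := rfl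
  -- basic facts about `σ`
  have hG2 := B.bigConst_spec.1
  have hG1 := B.one_le_bigConst
  have hGσ : B.bigConst ≤ (σ : ℝ) := hG'.trans (by exact_mod_cast hσG)
  have hσr2 : (2 : ℝ) ≤ σ := by linarith
  have hσone : 1 ≤ σ := by
    have : (1 : ℝ) ≤ σ := by linarith
    exact_mod_cast this
  have hσr1 : (1 : ℝ) < σ := by linarith
  have haFm : Fm.a * B.dd + 2 * Fm.b + 2 * n + 4 ≤ Fm.a * n := by rw [hFa, hFb]; exact ha
  have hexp : 1 + Fm.a * B.dd ≤ Fm.a * n := by omega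
  have ha1 : 1 ≤ Fm.a := by
    by_contra h0
    have : Fm.a = 0 := by omega
    rw [this] at haFm; omega
  have h1 : 1 ≤ B.gens.h := B.gens.one_le_h
  have hP₀σ : F.P₀ ≤ σ := le_trans (Nat.le_mul_of_pos_left _ (by have := F.hsp; omega)) hσP
  -- the sizes and `W` (for `fam`), then for the torsion family
  have hW1 : (1 : ℝ) ≤ (σ : ℝ) ^ (Fm.a * n + 1) := one_le_pow₀ (by linarith)
  have hσW' : B.hdeg * Family.κD n B.dd + 8 * n + n * Fm.ℓ + Family.κD n B.dd + 3 ≤ σ := by rw [hFℓ]; exact hσW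
  obtain ⟨sD, sT', sS₁, sS₀, sT, sP⟩ := Fm.sizes_le_W hn B.hdeg hσone hexp ha1 hσW'
  have hD'le : F.D' n B.dd σ ≤ Fm.D' n B.dd σ := F.D'_le_fam n B.dd hP₀σ
  have hDn : n * F.D' n B.dd σ ≤ Fm.Dn n B.dd σ := F.nD'_le_Dn n B.dd hP₀σ
  have hS₁le : F.S₁ n σ ≤ Fm.S₁ n σ := F.S₁_le_fam n σ
  have hrows : F.sp * F.Srows + 1 ≤ Family.S₀ n σ + 1 := F.sp_mul_Srows_lt n hn hσP
  have castW : ∀ {m : ℕ}, m ≤ σ ^ (Fm.a * n + 1) → (m : ℝ) ≤ (σ : ℝ) ^ (Fm.a * n + 1) := fun hm => by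
    exact_mod_cast hm
  have hWD : (F.D' n B.dd σ : ℝ) + 1 ≤ (σ : ℝ) ^ (Fm.a * n + 1) := by
    have := castW (le_trans (Nat.succ_le_succ hD'le) sD); push_cast at this; exact this
  have hWT' : (F.T' n σ : ℝ) ≤ (σ : ℝ) ^ (Fm.a * n + 1) := castW sT'
  have hWS₁ : (F.S₁ n σ : ℝ) + 1 ≤ (σ : ℝ) ^ (Fm.a * n + 1) := by
    have := castW (le_trans (Nat.succ_le_succ hS₁le) sS₁); push_cast at this; exact this
  have hWS₀ : (Family.S₀ n σ : ℝ) + 1 ≤ (σ : ℝ) ^ (Fm.a * n + 1) := by have := castW sS₀; push_cast at this; exact this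
  have hWSrows : ((F.sp * F.Srows : ℕ) : ℝ) + 1 ≤ (σ : ℝ) ^ (Fm.a * n + 1) := by
    have := castW (le_trans hrows sS₀); push_cast at this ⊢; linarith
  have hWT : ((Fintype.card (β ⊕ (γ ⊕ δ)) * F.D' n B.dd σ * B.hdeg : ℕ) : ℝ) + 2 * (F.T n σ) + 1 ≤
      (σ : ℝ) ^ (Fm.a * n + 1) := by
    rw [hn']
    have h0 : n * F.D' n B.dd σ * B.hdeg + 2 * Fm.T n σ + 1 ≤ σ ^ (Fm.a * n + 1) :=
      le_trans (by have := Nat.mul_le_mul_right B.hdeg hDn; unfold Family.Dn at this; omega) sT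
    have := castW h0; push_cast at this ⊢; rw [hT]; linarith
  have hWP : ((Fintype.card (β ⊕ (γ ⊕ δ)) * F.D' n B.dd σ * B.hdeg : ℕ) : ℝ) + 2 * (F.T' n σ) ≤
      (σ : ℝ) ^ (Fm.a * n + 1) := by
    rw [hn']
    have h0 : n * F.D' n B.dd σ * B.hdeg + 2 * Fm.T' n σ ≤ σ ^ (Fm.a * n + 1) :=
      le_trans (by have := Nat.mul_le_mul_right B.hdeg hDn; unfold Family.Dn at this; omega) sP
    have := castW h0; push_cast at this ⊢; rw [hT']; linarith
  have hqp : 2 * ((F.Srows + 1) * F.T n σ ^ B.dd) ≤ (F.D' n B.dd σ + 1) ^ Fintype.card (β ⊕ (γ ⊕ δ)) := by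
    rw [hn']; exact F.two_p_le_q n B.dd hn σ
  have hp : 0 < (F.Srows + 1) * F.T n σ ^ B.dd := Nat.mul_pos (Nat.succ_pos _) (pow_pos (Fm.T_pos n hn hσone) _)
  -- `R`, `θ`
  obtain ⟨hR0, hR2⟩ := F.R_bounds n hn hσone
  have hRR' : F.R n σ ≤ (Fm.R' n σ : ℝ) := F.R_le_R' n hn hσone
  have hθ1 : ((σ : ℝ) ^ F.b)⁻¹ ≤ 1 := inv_le_one_of_one_le₀ (one_le_pow₀ (by linarith))
  have hθeq : 2 * ((F.S₁ n σ : ℝ) + F.sp * Family.S₀ n σ) / F.R n σ ≤ ((σ : ℝ) ^ F.b)⁻¹ := by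
    have hRdef : F.R n σ = (σ : ℝ) ^ F.b * (2 * ((F.S₁ n σ : ℝ) + F.sp * Family.S₀ n σ)) := rfl
    have hsum : (0 : ℝ) < 2 * ((F.S₁ n σ : ℝ) + F.sp * Family.S₀ n σ) := by
      rw [hRdef] at hR0
      have hbpos : (0 : ℝ) < (σ : ℝ) ^ F.b := by positivity
      exact (pos_iff_pos_of_mul_pos hR0).mp hbpos
    rw [hRdef, div_le_iff₀ (by positivity)]
    rw [show ((σ : ℝ) ^ F.b)⁻¹ * ((σ : ℝ) ^ F.b * (2 * ((F.S₁ n σ : ℝ) + F.sp * Family.S₀ n σ))) =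
      2 * ((F.S₁ n σ : ℝ) + F.sp * Family.S₀ n σ) from by field_simp]
  intro s hs k hk
  have hk' : k ≤ F.T' n σ := hk.le
  have hsFm : s ≤ Fm.S₁ n σ := hs.trans hS₁le
  -- the envelopes (torsion versions)
  have e1 := B.orderLoss_le hk' hW1 hWT'
  have eU : (Fintype.card (UIdx β γ δ (F.D' n B.dd σ)) : ℝ) ≤ ((σ : ℝ) ^ (Fm.a * n + 1)) ^ n := by
    rw [card_UIdx, hn']; push_cast; exact pow_le_pow_left₀ (by positivity) hWD n
  have e3 := B.houseXi_le₃ ξ hξ hW1 hWD hqp hp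
  have eA₃ := B.houseBound_le (F.D' n B.dd σ) (F.T n σ) (F.sp * F.Srows) hW1 hWT hWSrows
  have e4₃ := B.growth_le (Fintype.card (β ⊕ (γ ⊕ δ)) * F.D' n B.dd σ) hR0.le hRR' hG'
  have e5 := saving_le₃ (T := F.T n σ) hR0 hθeq hθ1 hs hk'
  have e6₃ := B.dAt_pow_le (D := Fintype.card (β ⊕ (γ ⊕ δ)) * F.D' n B.dd σ) hs hk'
  have e7₃ := B.lineValBound_le₃ ξ hξ hW1 hWD hqp hp hWT' hWP hWS₁ hs hk'
  -- rename `card` to `n` in the envelopes and in the goal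
  rw [hn'] at e3 eA₃ e4₃ e6₃ e7₃
  rw [hn']
  -- notation for the real quantities
  have hG0 : (0 : ℝ) ≤ B.bigConst := by linarith
  have hσ0 : (0 : ℝ) ≤ σ := by linarith
  have hWr0 : (0 : ℝ) ≤ (σ : ℝ) ^ (Fm.a * n + 1) := by positivity
  have hθ0 : (0 : ℝ) ≤ ((σ : ℝ) ^ F.b)⁻¹ := by positivity
  set A₃ := B.houseBound (F.D' n B.dd σ) (F.T n σ) (F.sp * F.Srows) with hA₃
  have hA1 : 1 ≤ A₃ := B.one_le_houseBound _ _ _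
  have hA0 : (0 : ℝ) ≤ A₃ := zero_le_one.trans hA1
  -- exponent comparisons with `fam`
  have hET : B.expE (n * F.D' n B.dd σ) (F.T n σ) ≤ Fm.ET n B.dd B.hdeg σ := by
    have := B.expE_mono_left hDn (F.T n σ)
    exact this.trans (le_of_eq rfl)
  have hE' : B.expE (n * F.D' n B.dd σ) (F.T' n σ) ≤ Fm.E' n B.dd B.hdeg σ := by
    have := B.expE_mono_left hDn (F.T' n σ)
    exact this.trans (le_of_eq rfl)
  have hDh : n * F.D' n B.dd σ * B.hdeg ≤ Fm.Dn n B.dd σ * B.hdeg := Nat.mul_le_mul_right _ hDn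
  -- the `fam` envelope of the house bound
  set EA : ℝ := B.bigConst ^ ((Family.S₀ n σ + 1) * Fm.ET n B.dd B.hdeg σ + 2 * Fm.T n σ + Fm.Dn n B.dd σ +
      (Family.S₀ n σ + 1) * (Fm.Dn n B.dd σ * B.hdeg + 2 * Fm.T n σ)) *
    ((σ : ℝ) ^ (Fm.a * n + 1)) ^ (Fm.T n σ + (Fm.Dn n B.dd σ * B.hdeg + 2 * Fm.T n σ)) with hEA
  have hEA0 : 0 ≤ EA := by rw [hEA]; positivity
  have eA : A₃ ≤ EA := by
    refine eA₃.trans ?_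
    rw [hEA, ← hT]
    refine mul_le_mul (B.bigConst_pow_mono ?_) (pow_le_pow_right₀ hW1 ?_) (by positivity) (by positivity)
    · have h2 : (F.sp * F.Srows + 1) * B.expE (n * F.D' n B.dd σ) (F.T n σ) ≤
          (Family.S₀ n σ + 1) * Fm.ET n B.dd B.hdeg σ := Nat.mul_le_mul hrows hET
      have h3 : (F.sp * F.Srows + 1) * (n * F.D' n B.dd σ * B.hdeg + 2 * F.T n σ) ≤
          (Family.S₀ n σ + 1) * (Fm.Dn n B.dd σ * B.hdeg + 2 * F.T n σ) :=
        Nat.mul_le_mul hrows (Nat.add_le_add_right hDh _)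
      omega
    · omega
  have e3' : B.houseXi ξ ≤ B.bigConst ^ 3 * ((σ : ℝ) ^ (Fm.a * n + 1)) ^ (2 * n) * EA :=
    e3.trans (mul_le_mul_of_nonneg_left eA (by positivity))
  have e4 : Real.exp (thetaGrowthC (β := β) B.L B.κM * (1 + (F.R n σ * ‖B.v‖ + 1) ^ 2)) ^ (n * F.D' n B.dd σ) ≤
      B.bigConst ^ (Fm.Dn n B.dd σ * (1 + (Fm.R' n σ + 1) ^ 2 * G' ^ 2)) :=
    e4₃.trans (B.bigConst_pow_mono (Nat.mul_le_mul_right _ hDn))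
  have e6 : |(B.dAt s : ℝ)| ^ B.expE (n * F.D' n B.dd σ) k ≤ B.bigConst ^ ((Fm.S₁ n σ + 1) * Fm.E' n B.dd B.hdeg σ) :=
    e6₃.trans (B.bigConst_pow_mono (Nat.mul_le_mul (Nat.succ_le_succ hS₁le) hE'))
  have e7' : B.lineValBound ξ s k ≤
      B.bigConst ^ (2 * Fm.T' n σ + 3 + Fm.Dn n B.dd σ + (Fm.S₁ n σ + 1) * (Fm.Dn n B.dd σ * B.hdeg + 2 * Fm.T' n σ)) *
        ((σ : ℝ) ^ (Fm.a * n + 1)) ^ (2 * Fm.T' n σ + 3 * n + (Fm.Dn n B.dd σ * B.hdeg + 2 * Fm.T' n σ)) * EA := by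
    refine e7₃.trans ?_
    rw [← hT']
    refine mul_le_mul (mul_le_mul (B.bigConst_pow_mono ?_) (pow_le_pow_right₀ hW1 ?_) (by positivity) (by positivity))
      eA hA0 (by positivity)
    · have h3 : (F.S₁ n σ + 1) * (n * F.D' n B.dd σ * B.hdeg + 2 * F.T' n σ) ≤
          (Fm.S₁ n σ + 1) * (Fm.Dn n B.dd σ * B.hdeg + 2 * F.T' n σ) :=
        Nat.mul_le_mul (Nat.succ_le_succ hS₁le) (Nat.add_le_add_right hDh _)
      omega
    · omega
  -- nonnegativity of the true factors
  have n1 : (0 : ℝ) ≤ (k.factorial : ℝ) * ((k : ℝ) * B.dirNorm + 1) ^ k := by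
    have := B.dirNorm_nonneg; positivity
  have nU : (0 : ℝ) ≤ (Fintype.card (UIdx β γ δ (F.D' n B.dd σ)) : ℝ) := Nat.cast_nonneg _
  have nH : (0 : ℝ) ≤ B.houseXi ξ := zero_le_one.trans (B.one_le_houseXi ξ)
  have nG : (0 : ℝ) ≤ Real.exp (thetaGrowthC (β := β) B.L B.κM * (1 + (F.R n σ * ‖B.v‖ + 1) ^ 2)) ^ (n * F.D' n B.dd σ) :=
    pow_nonneg (Real.exp_nonneg _) _
  have nS : (0 : ℝ) ≤ (2 * ((s : ℝ) + F.sp * Family.S₀ n σ) / F.R n σ) ^ ((F.T n σ - k) * (Family.S₀ n σ + 1)) := by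
    positivity
  have nD : (0 : ℝ) ≤ |(B.dAt s : ℝ)| ^ B.expE (n * F.D' n B.dd σ) k := by positivity
  have nL : (0 : ℝ) ≤ B.lineValBound ξ s k := B.lineValBound_nonneg ξ s k
  -- block 2: `#U · H_ξ · growth`
  have b2 : (Fintype.card (UIdx β γ δ (F.D' n B.dd σ)) : ℝ) * B.houseXi ξ *
        Real.exp (thetaGrowthC (β := β) B.L B.κM * (1 + (F.R n σ * ‖B.v‖ + 1) ^ 2)) ^ (n * F.D' n B.dd σ) ≤
      ((σ : ℝ) ^ (Fm.a * n + 1)) ^ n * (B.bigConst ^ 3 * ((σ : ℝ) ^ (Fm.a * n + 1)) ^ (2 * n) * EA) *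
        B.bigConst ^ (Fm.Dn n B.dd σ * (1 + (Fm.R' n σ + 1) ^ 2 * G' ^ 2)) :=
    mul_le_mul (mul_le_mul eU e3' nH (by positivity)) e4 nG (by positivity)
  -- block 4: the Liouville factors
  have b4 : |(B.dAt s : ℝ)| ^ B.expE (n * F.D' n B.dd σ) k *
        (|(B.dAt s : ℝ)| ^ B.expE (n * F.D' n B.dd σ) k * B.lineValBound ξ s k) ^ (B.gens.h - 1) ≤
      B.bigConst ^ ((Fm.S₁ n σ + 1) * Fm.E' n B.dd B.hdeg σ) *
        (B.bigConst ^ ((Fm.S₁ n σ + 1) * Fm.E' n B.dd B.hdeg σ) *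
          (B.bigConst ^ (2 * Fm.T' n σ + 3 + Fm.Dn n B.dd σ + (Fm.S₁ n σ + 1) * (Fm.Dn n B.dd σ * B.hdeg + 2 * Fm.T' n σ)) *
            ((σ : ℝ) ^ (Fm.a * n + 1)) ^ (2 * Fm.T' n σ + 3 * n + (Fm.Dn n B.dd σ * B.hdeg + 2 * Fm.T' n σ)) * EA)) ^
        (B.gens.h - 1) :=
    mul_le_mul e6 (pow_le_pow_left₀ (by positivity) (mul_le_mul e6 e7' nL (by positivity)) _) (by positivity)
      (by positivity)
  -- the saving factor in the `fam` normalisation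
  have e5' : (2 * ((s : ℝ) + F.sp * Family.S₀ n σ) / F.R n σ) ^ ((F.T n σ - k) * (Family.S₀ n σ + 1)) ≤
      (((σ : ℝ) ^ F.b)⁻¹) ^ (Fm.Msave n σ) := by
    refine e5.trans (le_of_eq ?_)
    rfl
  have e1' : (k.factorial : ℝ) * ((k : ℝ) * B.dirNorm + 1) ^ k ≤ (B.bigConst * (σ : ℝ) ^ (Fm.a * n + 1)) ^ (2 * Fm.T' n σ) := e1
  -- the whole left-hand side
  have hLHS := mul_le_mul (mul_le_mul (mul_le_mul e1' b2 (by positivity) (by positivity)) e5' nS (by positivity))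
    b4 (by positivity) (by positivity)
  refine lt_of_le_of_lt hLHS ?_
  -- collect the exponents
  obtain ⟨h₁, hh₁⟩ : ∃ h₁, B.gens.h = h₁ + 1 := ⟨B.gens.h - 1, by omega⟩
  have hX := Fm.exponent_ineq (n := n) (dd := B.dd) (h := B.gens.h) (hdeg := B.hdeg) (G' := G') hn haFm hb hσone
    (by rw [hFℓ]; exact hσ1) (by rw [hFℓ]; exact hσ2) hσ3
  have key : B.bigConst ^ (Fm.X₁ n B.dd B.gens.h B.hdeg G' σ) * ((σ : ℝ) ^ (Fm.a * n + 1)) ^ (Fm.X₂ n B.dd B.gens.h B.hdeg σ) *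
      (((σ : ℝ) ^ F.b)⁻¹) ^ (Fm.Msave n σ) <
      (B.thetaLowc * Real.exp (-(B.thetaLowC * (1 + (s : ℝ) ^ 2)))) ^ (n * F.D' n B.dd σ) := by
    -- right-hand side from below
    have hY : n * F.D' n B.dd σ * (2 + s ^ 2) ≤ Fm.Y n B.dd σ := by
      unfold Family.Y
      exact Nat.mul_le_mul hDn (Nat.add_le_add_left (Nat.pow_le_pow_left hsFm 2) 2)
    have hR := B.rhs_ge (n * F.D' n B.dd σ) s
    have hR' : ((σ : ℝ) ^ Fm.Y n B.dd σ)⁻¹ ≤ (B.thetaLowc * Real.exp (-(B.thetaLowC * (1 + (s : ℝ) ^ 2)))) ^ (n * F.D' n B.dd σ) := by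
      refine le_trans ?_ hR
      rw [inv_le_inv₀ (by positivity) (by positivity)]
      calc B.bigConst ^ (n * F.D' n B.dd σ * (2 + s ^ 2)) ≤ (σ : ℝ) ^ (n * F.D' n B.dd σ * (2 + s ^ 2)) :=
            pow_le_pow_left₀ hG0 hGσ _
        _ ≤ (σ : ℝ) ^ Fm.Y n B.dd σ := pow_le_pow_right₀ hσr1.le hY
    refine lt_of_lt_of_le ?_ hR'
    -- left-hand side from above, as a single power of `σ`
    have hGX : B.bigConst ^ (Fm.X₁ n B.dd B.gens.h B.hdeg G' σ) ≤ (σ : ℝ) ^ (Fm.X₁ n B.dd B.gens.h B.hdeg G' σ) :=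
      pow_le_pow_left₀ hG0 hGσ _
    have hpos : (0 : ℝ) < (σ : ℝ) ^ (Fm.b * Fm.Msave n σ) := by positivity
    have hposY : (0 : ℝ) < (σ : ℝ) ^ Fm.Y n B.dd σ := by positivity
    calc B.bigConst ^ (Fm.X₁ n B.dd B.gens.h B.hdeg G' σ) * ((σ : ℝ) ^ (Fm.a * n + 1)) ^ (Fm.X₂ n B.dd B.gens.h B.hdeg σ) *
          (((σ : ℝ) ^ F.b)⁻¹) ^ (Fm.Msave n σ)
        ≤ (σ : ℝ) ^ (Fm.X₁ n B.dd B.gens.h B.hdeg G' σ) * ((σ : ℝ) ^ (Fm.a * n + 1)) ^ (Fm.X₂ n B.dd B.gens.h B.hdeg σ) *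
          (((σ : ℝ) ^ F.b)⁻¹) ^ (Fm.Msave n σ) :=
          mul_le_mul_of_nonneg_right (mul_le_mul_of_nonneg_right hGX (by positivity)) (by positivity)
      _ = (σ : ℝ) ^ (Fm.X₁ n B.dd B.gens.h B.hdeg G' σ + (Fm.a * n + 1) * Fm.X₂ n B.dd B.gens.h B.hdeg σ) *
          ((σ : ℝ) ^ (Fm.b * Fm.Msave n σ))⁻¹ := by
          rw [hFb, inv_pow, ← pow_mul, ← pow_mul, pow_add]
      _ < ((σ : ℝ) ^ Fm.Y n B.dd σ)⁻¹ := by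
          have hmain : (σ : ℝ) ^ (Fm.X₁ n B.dd B.gens.h B.hdeg G' σ + (Fm.a * n + 1) * Fm.X₂ n B.dd B.gens.h B.hdeg σ) *
              (σ : ℝ) ^ Fm.Y n B.dd σ < (σ : ℝ) ^ (Fm.b * Fm.Msave n σ) := by
            rw [← pow_add]; exact pow_lt_pow_right₀ hσr1 hX
          rw [inv_eq_one_div ((σ : ℝ) ^ Fm.Y n B.dd σ), lt_div_iff₀ hposY, mul_assoc,
            mul_comm (((σ : ℝ) ^ (Fm.b * Fm.Msave n σ))⁻¹), ← mul_assoc, ← div_eq_mul_inv, div_lt_one hpos]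
          exact hmain
  refine lt_of_eq_of_lt ?_ key
  rw [hEA]
  unfold Family.X₁ Family.X₂ Family.Msave Family.NA₁ Family.NA₂ Family.L₁ Family.L₂ Family.P₁ Family.Dn
  rw [hh₁, Nat.add_sub_cancel]
  ring

/-! ### `AdmissibleParams₃` -/

/-- The admissible-parameter hypothesis of the torsion-case closing: for the Baker datum `B`,
the constant `c > 0`, the spacing `sp` and `S_rows + 1` rows there are parameters
`D', T, S₀, S, T″, R` with the hypotheses of the torsion engine `NewPointsTorsion.engine₃`
(`T ≥ 1`, `(S_rows+1)T^{dd} < (D'+1)^n`, `R ≥ 2(nS + sp·S₀) > 0`, `NumCond₃` for every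
coefficient vector within `siegelHouseBound₃`, with `S₁ = nS`, `T' = nT″ + 1`), `D' ≥ 1`, `S ≥ 1`,
`sp ≤ S + 1`, and the zero-estimate numerics with the constant orbit factor `sp`: for all `e, m`
with `m < n` and `d·(n - m) ≤ e·n`, `c·D^n < binom(T″+e, e)·sp·D^m`, and
`c·D^n < binom(T″+e, e)·D^m` when the index inequality is strict (`D = nD'`).
[cite: BakerWustholz2007, §6.8 (pp. 117–119)] -/
def AdmissibleParams₃ (B : BakerData β γ δ) (d𝔟 : ℕ) (c : ℝ) (sp Srows : ℕ) : Prop :=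
  ∃ (D' T S₀ S T'' : ℕ) (R : ℝ), 0 < T ∧ 1 ≤ D' ∧ 1 ≤ S ∧ sp ≤ S + 1 ∧
    (Srows + 1) * T ^ B.dd < (D' + 1) ^ Fintype.card (β ⊕ (γ ⊕ δ)) ∧ 0 < R ∧
    2 * ((((Fintype.card (β ⊕ (γ ⊕ δ)) * S : ℕ)) : ℝ) + sp * S₀) ≤ R ∧
    (∀ ξ : BakerData.UIdx β γ δ D' → NumberField.RingOfIntegers B.K,
      (∀ u, NumberField.house ((ξ u : NumberField.RingOfIntegers B.K) : B.K) ≤ B.siegelHouseBound₃ sp D' T Srows) →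
        B.NumCond₃ ξ sp T S₀ (Fintype.card (β ⊕ (γ ⊕ δ)) * S) (Fintype.card (β ⊕ (γ ⊕ δ)) * T'' + 1) R) ∧
    ∀ e m : ℕ, m < Fintype.card (β ⊕ (γ ⊕ δ)) → d𝔟 * (Fintype.card (β ⊕ (γ ⊕ δ)) - m) ≤ e * Fintype.card (β ⊕ (γ ⊕ δ)) →
      c * ((Fintype.card (β ⊕ (γ ⊕ δ)) * D' : ℕ) : ℝ) ^ Fintype.card (β ⊕ (γ ⊕ δ)) <
          (Nat.choose (T'' + e) e : ℝ) * (sp : ℝ) * ((Fintype.card (β ⊕ (γ ⊕ δ)) * D' : ℕ) : ℝ) ^ m ∧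
      (d𝔟 * (Fintype.card (β ⊕ (γ ⊕ δ)) - m) < e * Fintype.card (β ⊕ (γ ⊕ δ)) →
        c * ((Fintype.card (β ⊕ (γ ⊕ δ)) * D' : ℕ) : ℝ) ^ Fintype.card (β ⊕ (γ ⊕ δ)) <
          (Nat.choose (T'' + e) e : ℝ) * ((Fintype.card (β ⊕ (γ ⊕ δ)) * D' : ℕ) : ℝ) ^ m)

/-- **`AdmissibleParams₃ B dd c sp S_rows` holds** for every Baker datum with `dd < n`, every
`c > 0`, every number of rows and every spacing `sp > c·κ₃^n·n!`, `κ₃ = n·2(4n)^{dd}(S_rows+1)`.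
The parameters are those of the torsion family with `ℓ = 1`, `b = b₀(fam₀)`, `a = 2b + 3n + 5`,
`σ` the sum of all thresholds. [cite: BakerWustholz2007, §6.8 (p. 119)] -/
theorem admissibleParams₃_of_lt (hdd : B.dd < Fintype.card (β ⊕ (γ ⊕ δ))) {c : ℝ} (hc : 0 < c)
    {sp : ℕ} (Srows : ℕ)
    (hspc : c * ((Fintype.card (β ⊕ (γ ⊕ δ)) * (2 * (4 * Fintype.card (β ⊕ (γ ⊕ δ))) ^ B.dd * (Srows + 1)) : ℕ) : ℝ) ^
      Fintype.card (β ⊕ (γ ⊕ δ)) * (Fintype.card (β ⊕ (γ ⊕ δ))).factorial < sp) :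
    AdmissibleParams₃ B B.dd c sp Srows := by
  classical
  set n := Fintype.card (β ⊕ (γ ⊕ δ)) with hn'
  -- `n ≥ 1`, `sp ≥ 1`
  have hn : 1 ≤ n := by omega
  have hsp1 : 1 ≤ sp := by
    have h0 : (0 : ℝ) ≤ c * ((n * (2 * (4 * n) ^ B.dd * (Srows + 1)) : ℕ) : ℝ) ^ n * (n.factorial : ℝ) := by positivity
    have : (0 : ℝ) < sp := lt_of_le_of_lt h0 hspc
    exact_mod_cast this
  -- the family
  set F₀ : TFamily := ⟨0, 0, 1, le_rfl, sp, hsp1, Srows + 1, Nat.succ_pos _⟩ with hF₀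
  set b : ℕ := Family.b₀ F₀.fam n B.dd B.gens.h B.hdeg with hb
  set a : ℕ := 2 * b + 3 * n + 5 with ha
  set F : TFamily := ⟨a, b, 1, le_rfl, sp, hsp1, Srows + 1, Nat.succ_pos _⟩ with hF
  have hfam : F.fam = ⟨a, b, 1 + sp, le_add_right le_rfl⟩ := rfl
  have hb₀ : Family.b₀ F.fam n B.dd B.gens.h B.hdeg ≤ F.b := by
    show Family.b₀ F.fam n B.dd B.gens.h B.hdeg ≤ b
    rw [hb]; exact le_of_eq rfl
  have haF : F.a * B.dd + 2 * F.b + 2 * n + 4 ≤ F.a * n := by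
    show a * B.dd + 2 * b + 2 * n + 4 ≤ a * n
    have h1 : a * (B.dd + 1) ≤ a * n := Nat.mul_le_mul_left a hdd
    have h2 : 2 * b + 2 * n + 4 ≤ a := by rw [ha]; omega
    nlinarith [h1, h2]
  have ha1 : 1 ≤ F.a := by show 1 ≤ a; rw [ha]; omega
  have hSrows : F.Srows = Srows := by show Srows + 1 - 1 = Srows; omega
  -- thresholds
  set G' : ℕ := ⌈B.bigConst⌉₊ with hG'
  have hGG' : B.bigConst ≤ G' := Nat.le_ceil _
  set K₀ : ℕ := ⌈c * ((n * (2 * (4 * n) ^ B.dd * (Srows + 1)) : ℕ) : ℝ) ^ n * (n.factorial : ℝ)⌉₊ + 1 with hK₀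
  set σ : ℕ := G' + Family.κD n B.dd * (1 + (2 * (n * (F.ℓ + F.sp)) + 3) ^ 2 * G' ^ 2) +
    Family.κD n B.dd * (2 + (n * (F.ℓ + F.sp)) ^ 2) +
    (F.a * n + 1) * (4 * n + 3 * n + B.gens.h * (4 * n + 3 * n + B.hdeg * Family.κD n B.dd + 4 * n) +
      B.gens.h * (4 * n + B.hdeg * Family.κD n B.dd + 8 * n)) +
    (B.hdeg * Family.κD n B.dd + 8 * n + n * (F.ℓ + F.sp) + Family.κD n B.dd + 3) + F.sp * F.P₀ + K₀ with hσ
  have hσG : G' ≤ σ := by rw [hσ]; omega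
  have hσ1 : Family.κD n B.dd * (1 + (2 * (n * (F.ℓ + F.sp)) + 3) ^ 2 * G' ^ 2) ≤ σ := by rw [hσ]; omega
  have hσ2 : Family.κD n B.dd * (2 + (n * (F.ℓ + F.sp)) ^ 2) ≤ σ := by rw [hσ]; omega
  have hσ3 : (F.a * n + 1) * (4 * n + 3 * n + B.gens.h * (4 * n + 3 * n + B.hdeg * Family.κD n B.dd + 4 * n) +
      B.gens.h * (4 * n + B.hdeg * Family.κD n B.dd + 8 * n)) ≤ σ := by rw [hσ]; omega
  have hσW : B.hdeg * Family.κD n B.dd + 8 * n + n * (F.ℓ + F.sp) + Family.κD n B.dd + 3 ≤ σ := by rw [hσ]; omega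
  have hσP : F.sp * F.P₀ ≤ σ := by rw [hσ]; omega
  have hσK₀ : K₀ ≤ σ := by rw [hσ]; omega
  have hσone : 1 ≤ σ := le_trans (by rw [hK₀]; omega) hσK₀
  have hσsp : F.sp ≤ σ := le_trans (Nat.le_mul_of_pos_right _ F.hP₀) hσP
  have hσK : c * ((n * (2 * (4 * n) ^ B.dd * F.P₀) : ℕ) : ℝ) ^ n * (n.factorial : ℝ) < σ := by
    show c * ((n * (2 * (4 * n) ^ B.dd * (Srows + 1)) : ℕ) : ℝ) ^ n * (n.factorial : ℝ) < σ
    have h1 := Nat.le_ceil (c * ((n * (2 * (4 * n) ^ B.dd * (Srows + 1)) : ℕ) : ℝ) ^ n * (n.factorial : ℝ))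
    have h2 : (K₀ : ℝ) ≤ σ := by exact_mod_cast hσK₀
    rw [hK₀] at h2; push_cast at h1 h2 ⊢; linarith
  have hspc' : c * ((n * (2 * (4 * n) ^ B.dd * F.P₀) : ℕ) : ℝ) ^ n * (n.factorial : ℝ) < F.sp := hspc
  -- the parameters
  obtain ⟨hR0, hR2⟩ := F.R_bounds n hn hσone
  have hS1 : F.sp ≤ F.S n σ + 1 := by
    unfold TFamily.S
    show sp ≤ 1 * σ ^ n + 1
    calc sp ≤ σ := hσsp
      _ = σ ^ 1 := (pow_one σ).symm
      _ ≤ σ ^ n := Nat.pow_le_pow_right hσone hn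
      _ ≤ 1 * σ ^ n + 1 := by omega
  refine ⟨F.D' n B.dd σ, F.T n σ, Family.S₀ n σ, F.S n σ, F.T₂ n σ, F.R n σ,
    F.fam.T_pos _ hn hσone, F.one_le_D' _ B.dd hn hσone, F.one_le_S _ hσone, hS1, ?_, hR0, ?_, ?_, ?_⟩
  · have := F.siegel_feasible n B.dd hn σ; rwa [hSrows] at this
  · have := hR2; unfold TFamily.S₁ at this; push_cast at this ⊢; exact this
  · intro ξ hξ
    have hξ' : ∀ u, NumberField.house ((ξ u : NumberField.RingOfIntegers B.K) : B.K) ≤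
        B.siegelHouseBound₃ F.sp (F.D' n B.dd σ) (F.T n σ) F.Srows := by rw [hSrows]; exact hξ
    have := B.numCond₃_family F hn'.symm hn haF hb₀ hGG' hσG hσ1 hσ2 hσ3 hσW hσP hξ'
    unfold TFamily.S₁ at this
    exact this
  · intro e m hm hidx
    exact F.numerics n B.dd hn hdd hc ha1 hspc' hσone hσK e m hm hidx

end BakerData

end Std

end GaGmE

end Literature.NumberTheory.Transcendental

end
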